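import Mathlib.Analysis.Normed.Lp.SmoothApprox
import Mathlib.MeasureTheory.Function.LpSeminorm.CompareExp
import Mathlib.MeasureTheory.Integral.Bochner.Basic
import Mathlib.MeasureTheory.Function.LpSpace.ContinuousFunctions
import HarnessLib

/-!
# Norming an `L^p` function by smooth compactly supported test functions

Analysis/FunctionSpaces support file (serves the `L^p` pressure estimate of the whole-space
Stokes system, `FluidPDE/StokesWholeSpacePressure`, on the decomposition path of
`Literature.Analysis.FluidPDE.stokes_interior_Lr_estimate`).

The easy ("norming") half of the duality `L^p = (L^{p'})*`, `1 < p < ∞`, against the dense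
class `C^∞_c`: if `f ∈ L^p(μ)` on a finite-dimensional real normed space and
`|∫ f φ dμ| ≤ B ‖φ‖_{p'}` for every smooth compactly supported `φ`, then `‖f‖_p ≤ B`
(`eLpNorm_le_of_forall_enorm_integral_mul_le`). Proof as in every textbook (Folland, *Real
Analysis*, Prop. 6.13; Brezis, *Functional Analysis*, proof of Thm. 4.11): test against the
extremal function `φ₀ = f |f|^{p-2} ∈ L^{p'}`, for which `∫ f φ₀ = ‖f‖_p^p` and
`‖φ₀‖_{p'} = ‖f‖_p^{p/p'}`, after approximating `φ₀` in `L^{p'}` by smooth compactly supported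
functions (Mathlib's `MeasureTheory.MemLp.exist_eLpNorm_sub_le`) and controlling the error by
Hölder's inequality.

## Main statements

* `enorm_integral_mul_le_eLpNorm_mul_eLpNorm`: Hölder for the real pairing,
  `‖∫ f g‖ₑ ≤ ‖f‖_p ‖g‖_{p'}`.
* `eLpNorm_le_of_forall_enorm_integral_mul_le`: the norming lemma.

## Mathlib search

`MeasureTheory.MemLp.exist_eLpNorm_sub_le` (density of `C^∞_c` in `L^p`, used),
`eLpNorm_le_eLpNorm_mul_eLpNorm_of_nnnorm` (Hölder, used), `ENNReal.HolderConjugate` (used);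
Mathlib has the `L^p`–`L^q` pairing as a bounded bilinear map (`MeasureTheory.Lp.holder`,
`Function/Holder`) but not the norming / isometry statement (searched `eLpNorm_le_of_forall`,
`norm_eq_iSup`, `dual` in `Function/LpSpace`: nothing).
-/

noncomputable section

open MeasureTheory Filter Function
open scoped ENNReal NNReal Topology ContDiff

namespace Literature.Analysis.FunctionSpaces

/-! ### Hölder for the real pairing -/

section Pairing

variable {α : Type*} [MeasurableSpace α] {μ : Measure α}

/-- **Hölder's inequality for the real pairing**: for conjugate exponents `p, q` and a.e.
strongly measurable real `f, g`, `‖∫ f g dμ‖ₑ ≤ ‖f‖_{L^p} ‖g‖_{L^q}` (no integrability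
hypothesis: a non-integrable pairing integrates to `0`). [folklore] -/
theorem enorm_integral_mul_le_eLpNorm_mul_eLpNorm {p q : ℝ≥0∞} [p.HolderConjugate q]
    {f g : α → ℝ} (hf : AEStronglyMeasurable f μ) (hg : AEStronglyMeasurable g μ) :
    ‖∫ x, f x * g x ∂μ‖ₑ ≤ eLpNorm f p μ * eLpNorm g q μ := by
  calc ‖∫ x, f x * g x ∂μ‖ₑ ≤ ∫⁻ x, ‖f x * g x‖ₑ ∂μ := enorm_integral_le_lintegral_enorm _
    _ = eLpNorm (fun x => f x * g x) 1 μ := by rw [eLpNorm_one_eq_lintegral_enorm]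
    _ ≤ (1 : ℝ≥0) * eLpNorm f p μ * eLpNorm g q μ :=
        eLpNorm_le_eLpNorm_mul_eLpNorm_of_nnnorm hf hg (· * ·) 1
          (Eventually.of_forall fun x => by simp [nnnorm_mul])
    _ = eLpNorm f p μ * eLpNorm g q μ := by simp

/-- The pairing of `f ∈ L^p` with `g ∈ L^q` is integrable (conjugate exponents). [folklore] -/
theorem integrable_mul_of_memLp {p q : ℝ≥0∞} [p.HolderConjugate q] {f g : α → ℝ}
    (hf : MemLp f p μ) (hg : MemLp g q μ) : Integrable (fun x => f x * g x) μ := by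
  rw [← memLp_one_iff_integrable]
  simpa [mul_comm] using hf.mul' hg

end Pairing

/-! ### The norming lemma -/

section Norming

variable {X : Type*} [NormedAddCommGroup X] [NormedSpace ℝ X] [FiniteDimensional ℝ X]
  [MeasurableSpace X] [BorelSpace X] {μ : Measure X} [IsFiniteMeasureOnCompacts μ]

/-- A small positive real `δ` with `M δ ≤ ε` for a finite `M : ℝ≥0∞` and `ε > 0`. [folklore] -/
theorem exists_pos_mul_ofReal_le {M : ℝ≥0∞} (hM : M ≠ ⊤) {ε : ℝ≥0} (hε : 0 < ε) :
    ∃ δ : ℝ, 0 < δ ∧ M * ENNReal.ofReal δ ≤ ε := by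
  have hM1 : M + 1 ≠ 0 := by simp
  have hM1' : M + 1 ≠ ⊤ := by simp [hM]
  set d : ℝ≥0∞ := (ε : ℝ≥0∞) / (M + 1) with hd
  have hd0 : d ≠ 0 := (ENNReal.div_pos (by exact_mod_cast hε.ne') hM1').ne'
  have hdtop : d ≠ ⊤ := ENNReal.div_ne_top ENNReal.coe_ne_top hM1
  refine ⟨d.toReal, ENNReal.toReal_pos hd0 hdtop, ?_⟩
  rw [ENNReal.ofReal_toReal hdtop]
  calc M * d ≤ (M + 1) * d := by gcongr; exact le_self_add
    _ = ε := ENNReal.mul_div_cancel hM1 hM1'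

/-- **Norming an `L^p` function by test functions** (the easy half of `L^p = (L^{p'})*`
against the dense class `C^∞_c`; Folland, *Real Analysis*, Prop. 6.13; Brezis, *Functional
Analysis*, proof of Thm. 4.11). Let `μ` be a measure finite on compact sets on a
finite-dimensional real normed space, `1 < p < ∞` with conjugate exponent `q`, and `f ∈ L^p(μ)`
real-valued. If `‖∫ f φ dμ‖ ≤ B ‖φ‖_{L^q}` for every `φ ∈ C^∞_c`, then `‖f‖_{L^p} ≤ B`.
(Test against `φ₀ = f|f|^{p-2}`, approximated in `L^q` by smooth compactly supported
functions.) [folklore] -/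
theorem eLpNorm_le_of_forall_enorm_integral_mul_le {p q : ℝ≥0∞} [hpq : p.HolderConjugate q]
    (hp : 1 < p) (hp' : p ≠ ⊤) {f : X → ℝ} (hf : MemLp f p μ) {B : ℝ≥0∞}
    (hB : ∀ φ : X → ℝ, ContDiff ℝ ∞ φ → HasCompactSupport φ →
      ‖∫ x, f x * φ x ∂μ‖ₑ ≤ B * eLpNorm φ q μ) :
    eLpNorm f p μ ≤ B := by
  rcases eq_or_ne B ⊤ with rfl | hBtop
  · exact le_top
  -- exponents
  have hp0 : p ≠ 0 := (zero_lt_one.trans hp).ne'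
  set r := p.toReal with hr
  have hr1 : 1 < r := by
    rw [hr, ← ENNReal.toReal_one, ENNReal.toReal_lt_toReal ENNReal.one_ne_top hp']
    exact hp
  have hr0 : 0 < r := one_pos.trans hr1
  have hqtop : q ≠ ⊤ :=
    ((ENNReal.HolderConjugate.lt_top_iff_one_lt (p := q) (q := p)).2 hp).ne
  have hq1 : 1 ≤ q := ENNReal.HolderConjugate.one_le (p := q) (q := p)
  have hq0 : q ≠ 0 := (zero_lt_one.trans_le hq1).ne'
  set s := q.toReal with hs
  have hrs : r.HolderConjugate s := ENNReal.HolderConjugate.toReal hr1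
  have hs0 : 0 < s := hrs.symm.pos
  have hrs' : (r - 1) * s = r := hrs.sub_one_mul_conj
  have hinv : 1 / r + 1 / s = 1 := by simpa [one_div] using hrs.inv_add_inv_eq_one
  -- the extremal test function `φ₀ = f |f|^{r-2}`
  set φ₀ : X → ℝ := fun x => f x * ‖f x‖ ^ (r - 2) with hφ₀
  have hφ₀_mul : ∀ x, f x * φ₀ x = ‖f x‖ ^ r := fun x => by
    simp only [hφ₀]
    rcases eq_or_ne (f x) 0 with h0 | h0
    · rw [h0, zero_mul, norm_zero, Real.zero_rpow hr0.ne']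
    · have hn : 0 < ‖f x‖ := norm_pos_iff.2 h0
      have e2 : f x ^ 2 = ‖f x‖ ^ ((2 : ℕ) : ℝ) := by
        rw [Real.rpow_natCast, Real.norm_eq_abs, sq_abs]
      rw [← mul_assoc, ← pow_two, e2, ← Real.rpow_add hn]
      congr 1
      push_cast
      ring
  have hφ₀_norm : ∀ x, ‖φ₀ x‖ = ‖f x‖ ^ (r - 1) := fun x => by
    simp only [hφ₀]
    rcases eq_or_ne (f x) 0 with h0 | h0
    · rw [h0, zero_mul, norm_zero, Real.zero_rpow (by linarith)]
    · have hn : 0 < ‖f x‖ := norm_pos_iff.2 h0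
      rw [norm_mul, Real.norm_of_nonneg (Real.rpow_nonneg (norm_nonneg _) _),
        ← Real.rpow_one_add' (norm_nonneg _) (by linarith)]
      congr 1
      ring
  have hφ₀_meas : AEStronglyMeasurable φ₀ μ :=
    (hf.1.aemeasurable.mul (hf.1.aemeasurable.norm.pow_const _)).aestronglyMeasurable
  -- the integral `I = ∫ |f|^r`
  set I : ℝ≥0∞ := ∫⁻ x, ‖f x‖ₑ ^ r ∂μ with hI
  have hItop : I < ⊤ := lintegral_rpow_enorm_lt_top_of_eLpNorm_lt_top hp0 hp' hf.2
  have hf_eq : eLpNorm f p μ = I ^ (1 / r) := eLpNorm_eq_lintegral_rpow_enorm_toReal hp0 hp'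
  have henorm_rpow : ∀ (t : ℝ) (e : ℝ), 0 ≤ t → 0 < e →
      ‖t ^ e‖ₑ = (ENNReal.ofReal t) ^ e := fun t e ht he => by
    rw [Real.enorm_eq_ofReal (Real.rpow_nonneg ht _), ENNReal.ofReal_rpow_of_nonneg ht he.le]
  have hφ₀_eq : eLpNorm φ₀ q μ = I ^ (1 / s) := by
    rw [eLpNorm_eq_lintegral_rpow_enorm_toReal hq0 hqtop, ← hs]
    congr 1
    refine lintegral_congr fun x => ?_
    rw [← enorm_norm (φ₀ x), hφ₀_norm, henorm_rpow _ _ (norm_nonneg _) (by linarith),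
      ofReal_norm, ← ENNReal.rpow_mul, hrs']
  have hφ₀_memLp : MemLp φ₀ q μ := by
    refine ⟨hφ₀_meas, ?_⟩
    rw [hφ₀_eq]
    exact ENNReal.rpow_lt_top_of_nonneg (by positivity) hItop.ne
  have hint : ‖∫ x, f x * φ₀ x ∂μ‖ₑ = I := by
    simp_rw [hφ₀_mul]
    rw [integral_eq_lintegral_of_nonneg_ae (Eventually.of_forall fun x => by positivity)
      (hf.1.norm.aemeasurable.pow_const _).aestronglyMeasurable]
    have e : ∫⁻ x, ENNReal.ofReal (‖f x‖ ^ r) ∂μ = I := by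
      refine lintegral_congr fun x => ?_
      rw [← ofReal_norm, ENNReal.ofReal_rpow_of_nonneg (norm_nonneg _) hr0.le]
    rw [e, Real.enorm_eq_ofReal ENNReal.toReal_nonneg, ENNReal.ofReal_toReal hItop.ne]
  -- the main inequality `I ≤ B I^{1/s}`, by approximation of `φ₀`
  have key' : ‖∫ x, f x * φ₀ x ∂μ‖ₑ ≤ B * eLpNorm φ₀ q μ := by
    refine ENNReal.le_of_forall_pos_le_add fun ε hε _ => ?_
    set M := B + eLpNorm f p μ with hM
    have hMtop : M ≠ ⊤ := ENNReal.add_ne_top.2 ⟨hBtop, hf.2.ne⟩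
    obtain ⟨δ, hδ, hMδ⟩ := exists_pos_mul_ofReal_le hMtop hε
    obtain ⟨φ, hφc, hφs, hφδ⟩ := hφ₀_memLp.exist_eLpNorm_sub_le hqtop hq1 hδ
    have hφ_memLp : MemLp φ q μ := hφs.continuous.memLp_of_hasCompactSupport hφc
    have hφm : AEStronglyMeasurable φ μ := hφ_memLp.1
    have hi1 : Integrable (fun x => f x * φ x) μ := integrable_mul_of_memLp hf hφ_memLp
    have hi2 : Integrable (fun x => f x * (φ₀ x - φ x)) μ :=
      integrable_mul_of_memLp hf (hφ₀_memLp.sub hφ_memLp)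
    have hsplit : ∫ x, f x * φ₀ x ∂μ = (∫ x, f x * φ x ∂μ) + ∫ x, f x * (φ₀ x - φ x) ∂μ := by
      rw [← integral_add hi1 hi2]
      refine integral_congr_ae (Eventually.of_forall fun x => ?_)
      ring
    have htri : eLpNorm φ q μ ≤ eLpNorm φ₀ q μ + eLpNorm (φ₀ - φ) q μ := by
      have e : φ = φ₀ - (φ₀ - φ) := by simp
      conv_lhs => rw [e]
      exact eLpNorm_sub_le hφ₀_meas (hφ₀_meas.sub hφm) hq1
    calc ‖∫ x, f x * φ₀ x ∂μ‖ₑ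
        = ‖(∫ x, f x * φ x ∂μ) + ∫ x, f x * (φ₀ x - φ x) ∂μ‖ₑ := by rw [hsplit]
      _ ≤ ‖∫ x, f x * φ x ∂μ‖ₑ + ‖∫ x, f x * (φ₀ x - φ x) ∂μ‖ₑ := enorm_add_le _ _
      _ ≤ B * eLpNorm φ q μ + eLpNorm f p μ * eLpNorm (φ₀ - φ) q μ :=
          add_le_add (hB φ hφs hφc)
            (enorm_integral_mul_le_eLpNorm_mul_eLpNorm hf.1 (hφ₀_meas.sub hφm))
      _ ≤ B * (eLpNorm φ₀ q μ + eLpNorm (φ₀ - φ) q μ) +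
            eLpNorm f p μ * eLpNorm (φ₀ - φ) q μ := by gcongr
      _ = B * eLpNorm φ₀ q μ + M * eLpNorm (φ₀ - φ) q μ := by rw [hM]; ring
      _ ≤ B * eLpNorm φ₀ q μ + M * ENNReal.ofReal δ := by gcongr
      _ ≤ B * eLpNorm φ₀ q μ + ε := by gcongr
  have key : I ≤ B * I ^ (1 / s) := by rwa [hint, hφ₀_eq] at key'
  -- conclusion: cancel `I^{1/s}`
  rw [hf_eq]
  rcases eq_or_ne I 0 with hI0 | hI0
  · rw [hI0, ENNReal.zero_rpow_of_pos (by positivity)]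
    exact zero_le
  have hIs0 : I ^ (1 / s) ≠ 0 := by
    simp [ENNReal.rpow_eq_zero_iff, hI0, hItop.ne, hs0]
  have hIstop : I ^ (1 / s) ≠ ⊤ := ENNReal.rpow_ne_top_of_nonneg (by positivity) hItop.ne
  have hsplitI : I = I ^ (1 / r) * I ^ (1 / s) := by
    rw [← ENNReal.rpow_add _ _ hI0 hItop.ne, hinv, ENNReal.rpow_one]
  have key2 : I ^ (1 / r) * I ^ (1 / s) ≤ B * I ^ (1 / s) :=
    calc I ^ (1 / r) * I ^ (1 / s) = I := hsplitI.symm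
      _ ≤ B * I ^ (1 / s) := key
  exact (ENNReal.mul_le_mul_iff_left hIs0 hIstop).1 key2

end Norming

end Literature.Analysis.FunctionSpaces

end
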